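import Summits.Ventures.LatticeQCDFlow.Exactness.IMHCoupledEstimatorCLT
import Summits.Ventures.LatticeQCDFlow.Exactness.IMHCoupledEstimatorEfficiency
import Summits.Ventures.LatticeQCDFlow.Exactness.IMHCommonRandomNumbersMeetingTimeTotal
import HarnessLib

/-!
# The variance of the exactly unbiased coupled flow-MCMC estimator FROM BOTH SIDES: `|Var H_k − Var_π f| ≤ (1 − A)^k(c − a)²(2W² + W + 1)`,
# so `Var H_k → Var_π f` and `Var H_k > 0` as soon as `Var_π f` beats the burn-in term (dominated convergence along the truncations)

HONEST FRAMING: exact (Metropolis-corrected) sampling algorithms for lattice gauge theory;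
figures of merit are autocorrelation/cost numbers at stated couplings and volumes; no
continuum-physics claim.

Venture `LatticeQCDFlow` (cell pub-lqcd), topic `Exactness`; FANOUT row 30 (lean-1, GEN-39).  NEW WORK of the cell, general state
space with `MeasurableEq Ω`; sequel to GEN-37's `Exactness/IMHCoupledEstimatorEfficiency` (the TWO-SIDED certificate
`|E(H_{k,N} − π f)² − Var_π f| ≤ r^k(c − a)²(2W² + W + 1)` for every finite window `N`) and GEN-38's `…Untruncated` (Fatou: the UPPER side
at `N = ∞`; «NOT CLAIMED: a lower bound at `N = ∞`»).  Here the window is removed on both sides: the truncated mean-square errors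
CONVERGE to the untruncated one (dominated convergence — the truncations are dominated by `(M₀ + (c − a)T)²` with the square-integrable
total disagreement time `T` of GEN-38's `…MeetingTimeTotal`), so the two-sided certificate passes to `H_k = f(Y_k) + Σ_{n≥0} D_{k+n}`:

* §1 **`crnLag_tendsto_integral_truncated_sq`** — `E(H_{k,N} − m)² → E(H_k − m)²` as `N → ∞`, every real `m`, every initial coupling.
* §2 **`crnLag_untruncated_sq_sub_variance_abs_le`** — `|E(H_k − π f)² − Var_π f| ≤ r^k(c − a)²(2W² + W + 1)` (both sides);
  **`crnLag_untruncated_sq_ge_variance`** — the lower side spelled out; **`crnLag_untruncated_sq_pos`** — `E(H_k − π f)² > 0` whenever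
  `Var_π f > r^k(c − a)²(2W² + W + 1)`; **`crnLag_tendsto_untruncated_sq`** — `E(H_k − π f)² → Var_π f` as `k → ∞`.
* §3 (replicas) **`crnLag_untruncated_replica_variance_ge`**, **`crnLag_untruncated_replica_variance_pos`** — for a pair stream `Z_0` with
  the law of the pair chain one update ahead: `Var H_k(Z_0) ≥ Var_π f − r^k(c − a)²(2W² + W + 1)`, positive under the displayed condition —
  DISCHARGING the hypothesis `Var H_k > 0` of this generation's studentised CLT and coverage statements from an intrinsic condition on
  `f`, `A` and `k` alone.
Reading (gauge files): one coupled pair of two exact gauge samplers is worth exactly one equilibrium draw, up to `(1 − A)^k × const`, at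
`N = ∞` too; its variance is positive once `(1 − A)^k(c − a)²(2/A² + 1/A + 1) < Var_π f`.
NOT CLAIMED: the exact variance; the sign of `Var H_k − Var_π f`; anything for unbounded `f` or any value of `A`.  No `sorry`, no new
definitions, nothing cited as a fact.
-/

noncomputable section

namespace Summit.Ventures.LatticeQCDFlow.Exactness

open MeasureTheory ProbabilityTheory Function Finset Filter
open scoped ENNReal unitInterval Topology
open Summit.Ventures.LatticeQCDFlow.Scoring

variable {Ω : Type*} [MeasurableSpace Ω] {q : Measure Ω} [IsProbabilityMeasure q] {w : Ω → ℝ}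

/-! ## §1 The truncated mean-square errors converge to the untruncated one -/

omit [MeasurableSpace Ω] in
/-- Pathwise domination: `|H_{k,N}(z) − m| ≤ max|a||c| + |m| + (c − a)·Σ_{n<k+N} 1{z_n ∉ Δ}`. [ours, bookkeeping] -/
theorem abs_crnLagEstimator_sub_le_count {f : Ω → ℝ} {a c : ℝ} (ha : ∀ x, a ≤ f x) (hc : ∀ x, f x ≤ c) (k N : ℕ)
    (z : ℕ → Ω × Ω) (m : ℝ) :
    |f ((z k).2) + ∑ n ∈ range N, (f ((z (k + n)).1) - f ((z (k + n)).2)) - m| ≤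
      max |a| |c| + |m| + (c - a) * ∑ n ∈ range (k + N), (Set.diagonal Ω)ᶜ.indicator (1 : Ω × Ω → ℝ) (z n) := by
  have hca : 0 ≤ c - a := by linarith [ha (z k).2, hc (z k).2]
  have hD : ∀ n, |f ((z (k + n)).1) - f ((z (k + n)).2)| ≤ (c - a) * (Set.diagonal Ω)ᶜ.indicator (1 : Ω × Ω → ℝ) (z (k + n)) := by
    intro n
    by_cases hp : z (k + n) ∈ (Set.diagonal Ω)ᶜ
    · rw [Set.indicator_of_mem hp, Pi.one_apply, mul_one]
      exact abs_sub_le_iff.2 ⟨by linarith [hc (z (k + n)).1, ha (z (k + n)).2], by linarith [hc (z (k + n)).2, ha (z (k + n)).1]⟩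
    · have h : (z (k + n)).1 = (z (k + n)).2 := Set.mem_diagonal_iff.1 (not_not.1 (fun h => hp h))
      rw [Set.indicator_of_notMem hp, mul_zero, h, sub_self, abs_zero]
  have hS : |∑ n ∈ range N, (f ((z (k + n)).1) - f ((z (k + n)).2))| ≤
      (c - a) * ∑ n ∈ range (k + N), (Set.diagonal Ω)ᶜ.indicator (1 : Ω × Ω → ℝ) (z n) := by
    calc |∑ n ∈ range N, (f ((z (k + n)).1) - f ((z (k + n)).2))|
        ≤ ∑ n ∈ range N, (c - a) * (Set.diagonal Ω)ᶜ.indicator (1 : Ω × Ω → ℝ) (z (k + n)) :=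
          (abs_sum_le_sum_abs _ _).trans (sum_le_sum fun n _ => hD n)
      _ = (c - a) * ∑ n ∈ range N, (Set.diagonal Ω)ᶜ.indicator (1 : Ω × Ω → ℝ) (z (k + n)) := by rw [mul_sum]
      _ ≤ (c - a) * ∑ n ∈ range (k + N), (Set.diagonal Ω)ᶜ.indicator (1 : Ω × Ω → ℝ) (z n) := by
          refine mul_le_mul_of_nonneg_left ?_ hca
          rw [Finset.sum_range_add]
          exact le_add_of_nonneg_left (sum_nonneg fun n _ => Set.indicator_nonneg (fun _ _ => zero_le_one) _)
  have hf0 : |f ((z k).2)| ≤ max |a| |c| := abs_le_max_abs_abs (ha _) (hc _)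
  calc |f ((z k).2) + ∑ n ∈ range N, (f ((z (k + n)).1) - f ((z (k + n)).2)) - m|
      ≤ |f ((z k).2)| + |∑ n ∈ range N, (f ((z (k + n)).1) - f ((z (k + n)).2))| + |m| := by
        have := abs_add_le (f ((z k).2)) (∑ n ∈ range N, (f ((z (k + n)).1) - f ((z (k + n)).2)))
        have := abs_sub (f ((z k).2) + ∑ n ∈ range N, (f ((z (k + n)).1) - f ((z (k + n)).2))) m
        linarith
    _ ≤ max |a| |c| + |m| + (c - a) * ∑ n ∈ range (k + N), (Set.diagonal Ω)ᶜ.indicator (1 : Ω × Ω → ℝ) (z n) := by linarith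

/-- **`E(H_{k,N} − m)² → E(H_k − m)²` AS `N → ∞`** for every real `m`, from every initial coupling (`w` a `Fact`-measurable normalised
weight maximal at `x₀`; `MeasurableEq Ω`): dominated convergence, the truncations being dominated by `(max|a||c| + |m| + (c − a)T)²` with
the square-integrable total disagreement time `T`. [ours] -/
theorem crnLag_tendsto_integral_truncated_sq [MeasurableEq Ω] [Fact (Measurable w)] (hw0 : ∀ y, 0 < w y) {x₀ : Ω}
    (hmax : ∀ y, w y ≤ w x₀) [IsProbabilityMeasure (q.withDensity fun y => ENNReal.ofReal (w y))]
    (Khat : Kernel (Ω × Ω) (Ω × Ω)) [IsMarkovKernel Khat]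
    (hK : ∀ z : Ω × Ω, Khat z = (q.prod (volume : Measure unitInterval)).map (fun p : Ω × unitInterval =>
      ((if (p.2 : ℝ) * w z.1 ≤ w p.1 then p.1 else z.1), (if (p.2 : ℝ) * w z.2 ≤ w p.1 then p.1 else z.2))))
    (μ₀ : Measure (Ω × Ω)) [IsProbabilityMeasure μ₀] {f : Ω → ℝ} (hf : Measurable f) {a c : ℝ}
    (ha : ∀ x, a ≤ f x) (hc : ∀ x, f x ≤ c) (k : ℕ) (m : ℝ) :
    Tendsto (fun N => ∫ z, (f ((z k).2) + ∑ n ∈ range N, (f ((z (k + n)).1) - f ((z (k + n)).2)) - m) ^ 2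
        ∂(Kernel.trajMeasure (X := fun _ : ℕ => Ω × Ω) μ₀
          (fun n : ℕ => Khat.comap (fun h : (i : ↥(Finset.Iic n)) → Ω × Ω => h ⟨n, Finset.mem_Iic.2 le_rfl⟩)
            (measurable_pi_apply _)))) atTop
      (𝓝 (∫ z, (f ((z k).2) + ∑' n, (f ((z (k + n)).1) - f ((z (k + n)).2)) - m) ^ 2
        ∂(Kernel.trajMeasure (X := fun _ : ℕ => Ω × Ω) μ₀
          (fun n : ℕ => Khat.comap (fun h : (i : ↥(Finset.Iic n)) → Ω × Ω => h ⟨n, Finset.mem_Iic.2 le_rfl⟩)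
            (measurable_pi_apply _))))) := by
  set P := Kernel.trajMeasure (X := fun _ : ℕ => Ω × Ω) μ₀
      (fun n : ℕ => Khat.comap (fun h : (i : ↥(Finset.Iic n)) → Ω × Ω => h ⟨n, Finset.mem_Iic.2 le_rfl⟩)
        (measurable_pi_apply _)) with hP
  have hw : Measurable w := Fact.out
  have hca : 0 ≤ c - a := by linarith [ha x₀, hc x₀]
  have hD : MeasurableSet (Set.diagonal Ω) := measurableSet_diagonal
  have hIm : Measurable ((Set.diagonal Ω)ᶜ.indicator (1 : Ω × Ω → ℝ)) := measurable_one.indicator hD.compl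
  set M₀ : ℝ := max |a| |c| + |m| with hM₀
  -- the dominating function `(M₀ + (c − a)T)²`, integrable since `T ∈ L²`
  set g : (ℕ → Ω × Ω) → ℝ := fun z => (M₀ + (c - a) * ∑' n, (Set.diagonal Ω)ᶜ.indicator (1 : Ω × Ω → ℝ) (z n)) ^ 2 with hg
  have hTm : ∀ M, Measurable fun z : ℕ → Ω × Ω => ∑ n ∈ range M, (Set.diagonal Ω)ᶜ.indicator (1 : Ω × Ω → ℝ) (z n) := fun M =>
    Finset.measurable_sum _ fun n _ => hIm.comp (measurable_pi_apply n)
  have hTasm : AEStronglyMeasurable (fun z : ℕ → Ω × Ω => ∑' n, (Set.diagonal Ω)ᶜ.indicator (1 : Ω × Ω → ℝ) (z n)) P :=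
    aestronglyMeasurable_of_tendsto_ae atTop (fun M => (hTm M).aestronglyMeasurable) (by
      filter_upwards [crn_chain_ae_tendsto_disagreementCount hw hw0 hmax Khat hK μ₀] with z hz
      exact hz.2)
  have hT2 : MemLp (fun z : ℕ → Ω × Ω => ∑' n, (Set.diagonal Ω)ᶜ.indicator (1 : Ω × Ω → ℝ) (z n)) 2 P :=
    (memLp_two_iff_integrable_sq hTasm).2 (crn_chain_totalDisagreement_sq_integrable hw0 hmax Khat hK μ₀)
  have hgi : Integrable g P := ((memLp_const M₀).add (hT2.const_mul (c - a))).integrable_sq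
  have hFm : ∀ N, AEStronglyMeasurable (fun z : ℕ → Ω × Ω =>
      (f ((z k).2) + ∑ n ∈ range N, (f ((z (k + n)).1) - f ((z (k + n)).2)) - m) ^ 2) P := fun N =>
    (((measurable_crnLagEstimator hf k N).sub measurable_const).pow_const 2).aestronglyMeasurable
  have hbound : ∀ N, ∀ᵐ z ∂P, ‖(f ((z k).2) + ∑ n ∈ range N, (f ((z (k + n)).1) - f ((z (k + n)).2)) - m) ^ 2‖ ≤ g z := by
    intro N
    filter_upwards [crn_chain_ae_summable_disagreement hw hw0 hmax Khat hK μ₀] with z hz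
    have h1 := abs_crnLagEstimator_sub_le_count ha hc k N z m
    have h2 : ∑ n ∈ range (k + N), (Set.diagonal Ω)ᶜ.indicator (1 : Ω × Ω → ℝ) (z n) ≤
        ∑' n, (Set.diagonal Ω)ᶜ.indicator (1 : Ω × Ω → ℝ) (z n) :=
      hz.2.sum_le_tsum (range (k + N)) fun n _ => Set.indicator_nonneg (fun _ _ => zero_le_one) _
    have h3 : |f ((z k).2) + ∑ n ∈ range N, (f ((z (k + n)).1) - f ((z (k + n)).2)) - m| ≤
        M₀ + (c - a) * ∑' n, (Set.diagonal Ω)ᶜ.indicator (1 : Ω × Ω → ℝ) (z n) := by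
      have := mul_le_mul_of_nonneg_left h2 hca
      linarith
    rw [Real.norm_eq_abs, abs_pow, hg]
    exact pow_le_pow_left₀ (abs_nonneg _) h3 2
  exact tendsto_integral_of_dominated_convergence g hFm hgi hbound (crnLag_ae_tendsto_truncated hw hw0 hmax Khat hK μ₀ f k m)

/-! ## §2 The two-sided certificate at `N = ∞` -/

/-- **`|E(H_k − π f)² − Var_π f| ≤ r^k(c − a)²(2W² + W + 1)` — BOTH SIDES, UNTRUNCATED**, from every initial coupling. [ours] -/
theorem crnLag_untruncated_sq_sub_variance_abs_le [MeasurableEq Ω] [Fact (Measurable w)] (hw0 : ∀ y, 0 < w y) {x₀ : Ω}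
    (hmax : ∀ y, w y ≤ w x₀) [IsProbabilityMeasure (q.withDensity fun y => ENNReal.ofReal (w y))]
    (Khat : Kernel (Ω × Ω) (Ω × Ω)) [IsMarkovKernel Khat]
    (hK : ∀ z : Ω × Ω, Khat z = (q.prod (volume : Measure unitInterval)).map (fun p : Ω × unitInterval =>
      ((if (p.2 : ℝ) * w z.1 ≤ w p.1 then p.1 else z.1), (if (p.2 : ℝ) * w z.2 ≤ w p.1 then p.1 else z.2))))
    (μ₀ : Measure (Ω × Ω)) [IsProbabilityMeasure μ₀] {f : Ω → ℝ} (hf : Measurable f) {a c : ℝ}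
    (ha : ∀ x, a ≤ f x) (hc : ∀ x, f x ≤ c) (k : ℕ) :
    |∫ z, (f ((z k).2) + ∑' n, (f ((z (k + n)).1) - f ((z (k + n)).2)) -
          ∫ x, f x ∂(q.withDensity fun y => ENNReal.ofReal (w y))) ^ 2
        ∂(Kernel.trajMeasure (X := fun _ : ℕ => Ω × Ω) μ₀
          (fun n : ℕ => Khat.comap (fun h : (i : ↥(Finset.Iic n)) → Ω × Ω => h ⟨n, Finset.mem_Iic.2 le_rfl⟩)
            (measurable_pi_apply _))) -
      ∫ y, (f y - ∫ x, f x ∂(q.withDensity fun y => ENNReal.ofReal (w y))) ^ 2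
          ∂(q.withDensity fun y => ENNReal.ofReal (w y))| ≤
      (1 - (w x₀)⁻¹) ^ k * (c - a) ^ 2 * (2 * w x₀ ^ 2 + w x₀ + 1) := by
  set m := ∫ x, f x ∂(q.withDensity fun y => ENNReal.ofReal (w y)) with hm
  set V := ∫ y, (f y - m) ^ 2 ∂(q.withDensity fun y => ENNReal.ofReal (w y)) with hV
  have hlim := crnLag_tendsto_integral_truncated_sq hw0 hmax Khat hK μ₀ hf ha hc k m
  have hN : ∀ N, |∫ z, (f ((z k).2) + ∑ n ∈ range N, (f ((z (k + n)).1) - f ((z (k + n)).2)) - m) ^ 2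
        ∂(Kernel.trajMeasure (X := fun _ : ℕ => Ω × Ω) μ₀
          (fun n : ℕ => Khat.comap (fun h : (i : ↥(Finset.Iic n)) → Ω × Ω => h ⟨n, Finset.mem_Iic.2 le_rfl⟩)
            (measurable_pi_apply _))) - V| ≤ (1 - (w x₀)⁻¹) ^ k * (c - a) ^ 2 * (2 * w x₀ ^ 2 + w x₀ + 1) := fun N =>
    crnLag_truncated_sq_sub_variance_abs_le hw0 hmax Khat hK μ₀ hf ha hc k N
  exact le_of_tendsto' ((hlim.sub_const V).abs) hN

/-- **THE LOWER SIDE AT `N = ∞`: `E(H_k − π f)² ≥ Var_π f − r^k(c − a)²(2W² + W + 1)`**. [ours] -/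
theorem crnLag_untruncated_sq_ge_variance [MeasurableEq Ω] [Fact (Measurable w)] (hw0 : ∀ y, 0 < w y) {x₀ : Ω}
    (hmax : ∀ y, w y ≤ w x₀) [IsProbabilityMeasure (q.withDensity fun y => ENNReal.ofReal (w y))]
    (Khat : Kernel (Ω × Ω) (Ω × Ω)) [IsMarkovKernel Khat]
    (hK : ∀ z : Ω × Ω, Khat z = (q.prod (volume : Measure unitInterval)).map (fun p : Ω × unitInterval =>
      ((if (p.2 : ℝ) * w z.1 ≤ w p.1 then p.1 else z.1), (if (p.2 : ℝ) * w z.2 ≤ w p.1 then p.1 else z.2))))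
    (μ₀ : Measure (Ω × Ω)) [IsProbabilityMeasure μ₀] {f : Ω → ℝ} (hf : Measurable f) {a c : ℝ}
    (ha : ∀ x, a ≤ f x) (hc : ∀ x, f x ≤ c) (k : ℕ) :
    ∫ y, (f y - ∫ x, f x ∂(q.withDensity fun y => ENNReal.ofReal (w y))) ^ 2 ∂(q.withDensity fun y => ENNReal.ofReal (w y)) -
        (1 - (w x₀)⁻¹) ^ k * (c - a) ^ 2 * (2 * w x₀ ^ 2 + w x₀ + 1) ≤
      ∫ z, (f ((z k).2) + ∑' n, (f ((z (k + n)).1) - f ((z (k + n)).2)) -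
          ∫ x, f x ∂(q.withDensity fun y => ENNReal.ofReal (w y))) ^ 2
        ∂(Kernel.trajMeasure (X := fun _ : ℕ => Ω × Ω) μ₀
          (fun n : ℕ => Khat.comap (fun h : (i : ↥(Finset.Iic n)) → Ω × Ω => h ⟨n, Finset.mem_Iic.2 le_rfl⟩)
            (measurable_pi_apply _))) := by
  have h := crnLag_untruncated_sq_sub_variance_abs_le hw0 hmax Khat hK μ₀ hf ha hc k
  rw [abs_sub_le_iff] at h
  linarith [h.2]

/-- **POSITIVITY: `E(H_k − π f)² > 0` WHENEVER `Var_π f > r^k(c − a)²(2W² + W + 1)`**. [ours] -/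
theorem crnLag_untruncated_sq_pos [MeasurableEq Ω] [Fact (Measurable w)] (hw0 : ∀ y, 0 < w y) {x₀ : Ω}
    (hmax : ∀ y, w y ≤ w x₀) [IsProbabilityMeasure (q.withDensity fun y => ENNReal.ofReal (w y))]
    (Khat : Kernel (Ω × Ω) (Ω × Ω)) [IsMarkovKernel Khat]
    (hK : ∀ z : Ω × Ω, Khat z = (q.prod (volume : Measure unitInterval)).map (fun p : Ω × unitInterval =>
      ((if (p.2 : ℝ) * w z.1 ≤ w p.1 then p.1 else z.1), (if (p.2 : ℝ) * w z.2 ≤ w p.1 then p.1 else z.2))))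
    (μ₀ : Measure (Ω × Ω)) [IsProbabilityMeasure μ₀] {f : Ω → ℝ} (hf : Measurable f) {a c : ℝ}
    (ha : ∀ x, a ≤ f x) (hc : ∀ x, f x ≤ c) (k : ℕ)
    (hgap : (1 - (w x₀)⁻¹) ^ k * (c - a) ^ 2 * (2 * w x₀ ^ 2 + w x₀ + 1) <
      ∫ y, (f y - ∫ x, f x ∂(q.withDensity fun y => ENNReal.ofReal (w y))) ^ 2 ∂(q.withDensity fun y => ENNReal.ofReal (w y))) :
    0 < ∫ z, (f ((z k).2) + ∑' n, (f ((z (k + n)).1) - f ((z (k + n)).2)) -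
          ∫ x, f x ∂(q.withDensity fun y => ENNReal.ofReal (w y))) ^ 2
        ∂(Kernel.trajMeasure (X := fun _ : ℕ => Ω × Ω) μ₀
          (fun n : ℕ => Khat.comap (fun h : (i : ↥(Finset.Iic n)) → Ω × Ω => h ⟨n, Finset.mem_Iic.2 le_rfl⟩)
            (measurable_pi_apply _))) := by
  have h := crnLag_untruncated_sq_ge_variance hw0 hmax Khat hK μ₀ hf ha hc k
  linarith

/-- **`E(H_k − π f)² → Var_π f` AS `k → ∞`**, from every initial coupling (the burn-in term is `O(r^k)`, `r < 1`). [ours] -/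
theorem crnLag_tendsto_untruncated_sq [MeasurableEq Ω] [Fact (Measurable w)] (hw0 : ∀ y, 0 < w y) {x₀ : Ω}
    (hmax : ∀ y, w y ≤ w x₀) [IsProbabilityMeasure (q.withDensity fun y => ENNReal.ofReal (w y))]
    (Khat : Kernel (Ω × Ω) (Ω × Ω)) [IsMarkovKernel Khat]
    (hK : ∀ z : Ω × Ω, Khat z = (q.prod (volume : Measure unitInterval)).map (fun p : Ω × unitInterval =>
      ((if (p.2 : ℝ) * w z.1 ≤ w p.1 then p.1 else z.1), (if (p.2 : ℝ) * w z.2 ≤ w p.1 then p.1 else z.2))))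
    (μ₀ : Measure (Ω × Ω)) [IsProbabilityMeasure μ₀] {f : Ω → ℝ} (hf : Measurable f) {a c : ℝ}
    (ha : ∀ x, a ≤ f x) (hc : ∀ x, f x ≤ c) :
    Tendsto (fun k : ℕ => ∫ z, (f ((z k).2) + ∑' n, (f ((z (k + n)).1) - f ((z (k + n)).2)) -
          ∫ x, f x ∂(q.withDensity fun y => ENNReal.ofReal (w y))) ^ 2
        ∂(Kernel.trajMeasure (X := fun _ : ℕ => Ω × Ω) μ₀
          (fun n : ℕ => Khat.comap (fun h : (i : ↥(Finset.Iic n)) → Ω × Ω => h ⟨n, Finset.mem_Iic.2 le_rfl⟩)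
            (measurable_pi_apply _)))) atTop
      (𝓝 (∫ y, (f y - ∫ x, f x ∂(q.withDensity fun y => ENNReal.ofReal (w y))) ^ 2 ∂(q.withDensity fun y => ENNReal.ofReal (w y)))) := by
  have hW : 1 ≤ w x₀ := one_le_of_mode (q := q) hmax
  have hWpos : 0 < w x₀ := hw0 x₀
  have hr0 : 0 ≤ 1 - (w x₀)⁻¹ := sub_nonneg.2 (inv_le_one_of_one_le₀ hW)
  have hr1 : 1 - (w x₀)⁻¹ < 1 := sub_lt_self _ (inv_pos.2 hWpos)
  have hgeo : Tendsto (fun k : ℕ => (1 - (w x₀)⁻¹) ^ k * (c - a) ^ 2 * (2 * w x₀ ^ 2 + w x₀ + 1)) atTop (𝓝 0) := by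
    have h := (tendsto_pow_atTop_nhds_zero_of_lt_one hr0 hr1).mul_const ((c - a) ^ 2 * (2 * w x₀ ^ 2 + w x₀ + 1))
    rw [zero_mul] at h
    refine h.congr fun k => ?_
    ring
  set V := ∫ y, (f y - ∫ x, f x ∂(q.withDensity fun y => ENNReal.ofReal (w y))) ^ 2
    ∂(q.withDensity fun y => ENNReal.ofReal (w y)) with hV
  have hlo : Tendsto (fun k : ℕ => V - (1 - (w x₀)⁻¹) ^ k * (c - a) ^ 2 * (2 * w x₀ ^ 2 + w x₀ + 1)) atTop (𝓝 V) := by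
    have h := tendsto_const_nhds (x := V) (f := (atTop : Filter ℕ)) |>.sub hgeo
    rwa [sub_zero] at h
  have hup : Tendsto (fun k : ℕ => V + (1 - (w x₀)⁻¹) ^ k * (c - a) ^ 2 * (2 * w x₀ ^ 2 + w x₀ + 1)) atTop (𝓝 V) := by
    have h := tendsto_const_nhds (x := V) (f := (atTop : Filter ℕ)) |>.add hgeo
    rwa [add_zero] at h
  refine tendsto_of_tendsto_of_tendsto_of_le_of_le hlo hup (fun k => ?_) (fun k => ?_)
  · exact crnLag_untruncated_sq_ge_variance hw0 hmax Khat hK μ₀ hf ha hc k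
  · have h := crnLag_untruncated_sq_sub_variance_abs_le hw0 hmax Khat hK μ₀ hf ha hc k
    rw [abs_sub_le_iff] at h
    show _ ≤ V + _
    linarith [h.1]

/-! ## §3 Replicas: discharging `Var H_k > 0` -/

section Replicas

variable {Ω' : Type*} {mΩ' : MeasurableSpace Ω'} {μ : Measure Ω'} [IsProbabilityMeasure μ]
  {Z : ℕ → Ω' → (ℕ → Ω × Ω)}

/-- **`Var H_k(Z_0) ≥ Var_π f − r^k(c − a)²(2W² + W + 1)`** for a pair stream with the law of the pair chain from ONE initial coupling one
update ahead (then `E H_k(Z_0) = π f` exactly, so the variance is the mean-square error about `π f`). [ours] -/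
theorem crnLag_untruncated_replica_variance_ge [MeasurableEq Ω] [Fact (Measurable w)] (hw0 : ∀ y, 0 < w y) {x₀ : Ω}
    (hmax : ∀ y, w y ≤ w x₀) [IsProbabilityMeasure (q.withDensity fun y => ENNReal.ofReal (w y))]
    (Khat : Kernel (Ω × Ω) (Ω × Ω)) [IsMarkovKernel Khat]
    (hK : ∀ z : Ω × Ω, Khat z = (q.prod (volume : Measure unitInterval)).map (fun p : Ω × unitInterval =>
      ((if (p.2 : ℝ) * w z.1 ≤ w p.1 then p.1 else z.1), (if (p.2 : ℝ) * w z.2 ≤ w p.1 then p.1 else z.2))))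
    (ν : Measure (Ω × Ω)) [IsProbabilityMeasure ν] (hlag : ν.map Prod.fst = (ν.map Prod.snd).bind (indepMH q w))
    {f : Ω → ℝ} (hf : Measurable f) {a c : ℝ} (ha : ∀ x, a ≤ f x) (hc : ∀ x, f x ≤ c) (k : ℕ) (hZm : ∀ j, Measurable (Z j))
    (hlaw : ∀ j, μ.map (Z j) = Kernel.trajMeasure (X := fun _ : ℕ => Ω × Ω) ν
      (fun n : ℕ => Khat.comap (fun h : (i : ↥(Finset.Iic n)) → Ω × Ω => h ⟨n, Finset.mem_Iic.2 le_rfl⟩)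
        (measurable_pi_apply _))) :
    ∫ y, (f y - ∫ x, f x ∂(q.withDensity fun y => ENNReal.ofReal (w y))) ^ 2 ∂(q.withDensity fun y => ENNReal.ofReal (w y)) -
        (1 - (w x₀)⁻¹) ^ k * (c - a) ^ 2 * (2 * w x₀ ^ 2 + w x₀ + 1) ≤
      Var[fun ω => f ((Z 0 ω k).2) + ∑' n, (f ((Z 0 ω (k + n)).1) - f ((Z 0 ω (k + n)).2)); μ] := by
  set m := ∫ x, f x ∂(q.withDensity fun y => ENNReal.ofReal (w y)) with hm
  have hHasm' := fun j => (crnLag_untruncated_replicas_identDistrib hw0 hmax Khat hK ν hf k hZm hlaw j).1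
  have hX2 : MemLp (fun ω => f ((Z 0 ω k).2) + ∑' n, (f ((Z 0 ω (k + n)).1) - f ((Z 0 ω (k + n)).2))) 2 μ :=
    memLp_crnLag_untruncated_replica hw0 hmax Khat hK ν hf ha hc k hZm (hlaw 0)
  -- exact unbiasedness transferred along the law: `E H_k(Z_0) = π f`
  have hmean : μ[fun ω => f ((Z 0 ω k).2) + ∑' n, (f ((Z 0 ω (k + n)).1) - f ((Z 0 ω (k + n)).2))] = m := by
    rw [← integral_map (hZm 0).aemeasurable (hHasm' 0), hlaw 0]
    have hYi : Integrable (fun z : ℕ → Ω × Ω => f ((z k).2))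
        (Kernel.trajMeasure (X := fun _ : ℕ => Ω × Ω) ν
          (fun n : ℕ => Khat.comap (fun h : (i : ↥(Finset.Iic n)) → Ω × Ω => h ⟨n, Finset.mem_Iic.2 le_rfl⟩)
            (measurable_pi_apply _))) :=
      integrable_of_bounded _ (hf.comp (measurable_snd.comp (measurable_pi_apply k))) (fun z =>
        abs_le_max_abs_abs (ha _) (hc _))
    have hTi : Integrable (fun z : ℕ → Ω × Ω => ∑' n, (f ((z (k + n)).1) - f ((z (k + n)).2)))
        (Kernel.trajMeasure (X := fun _ : ℕ => Ω × Ω) ν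
          (fun n : ℕ => Khat.comap (fun h : (i : ↥(Finset.Iic n)) → Ω × Ω => h ⟨n, Finset.mem_Iic.2 le_rfl⟩)
            (measurable_pi_apply _))) := by
      have h := (crnLag_untruncated_memLp_two hw0 hmax Khat hK ν hf ha hc k).integrable one_le_two
      refine (h.sub hYi).congr (ae_of_all _ fun z => ?_)
      simp only [Pi.sub_apply, add_sub_cancel_left]
    rw [integral_add hYi hTi]
    exact crnLag_unbiased hw0 hmax Khat hK ν hlag hf ha hc k
  have h1 := integral_sub_const_sq hX2 m
  rw [hmean, sub_self, zero_pow two_ne_zero, add_zero] at h1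
  have hHasm : AEStronglyMeasurable
      (fun z : ℕ → Ω × Ω => (f ((z k).2) + ∑' n, (f ((z (k + n)).1) - f ((z (k + n)).2)) - m) ^ 2) (μ.map (Z 0)) := by
    rw [hlaw 0]; exact (crnLag_untruncated_sq_integrable hw0 hmax Khat hK ν hf ha hc k).aestronglyMeasurable
  have h2 := crnLag_untruncated_sq_ge_variance hw0 hmax Khat hK ν hf ha hc k
  rw [← hlaw 0, integral_map (hZm 0).aemeasurable hHasm] at h2
  rw [← h1]
  exact h2

/-- **`Var H_k(Z_0) > 0` WHENEVER `Var_π f > r^k(c − a)²(2W² + W + 1)`** — the hypothesis of the studentised CLT and of the coverage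
statement, discharged from `f`, `A`, `k` alone. [ours] -/
theorem crnLag_untruncated_replica_variance_pos [MeasurableEq Ω] [Fact (Measurable w)] (hw0 : ∀ y, 0 < w y) {x₀ : Ω}
    (hmax : ∀ y, w y ≤ w x₀) [IsProbabilityMeasure (q.withDensity fun y => ENNReal.ofReal (w y))]
    (Khat : Kernel (Ω × Ω) (Ω × Ω)) [IsMarkovKernel Khat]
    (hK : ∀ z : Ω × Ω, Khat z = (q.prod (volume : Measure unitInterval)).map (fun p : Ω × unitInterval =>
      ((if (p.2 : ℝ) * w z.1 ≤ w p.1 then p.1 else z.1), (if (p.2 : ℝ) * w z.2 ≤ w p.1 then p.1 else z.2))))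
    (ν : Measure (Ω × Ω)) [IsProbabilityMeasure ν] (hlag : ν.map Prod.fst = (ν.map Prod.snd).bind (indepMH q w))
    {f : Ω → ℝ} (hf : Measurable f) {a c : ℝ} (ha : ∀ x, a ≤ f x) (hc : ∀ x, f x ≤ c) (k : ℕ) (hZm : ∀ j, Measurable (Z j))
    (hlaw : ∀ j, μ.map (Z j) = Kernel.trajMeasure (X := fun _ : ℕ => Ω × Ω) ν
      (fun n : ℕ => Khat.comap (fun h : (i : ↥(Finset.Iic n)) → Ω × Ω => h ⟨n, Finset.mem_Iic.2 le_rfl⟩)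
        (measurable_pi_apply _)))
    (hgap : (1 - (w x₀)⁻¹) ^ k * (c - a) ^ 2 * (2 * w x₀ ^ 2 + w x₀ + 1) <
      ∫ y, (f y - ∫ x, f x ∂(q.withDensity fun y => ENNReal.ofReal (w y))) ^ 2 ∂(q.withDensity fun y => ENNReal.ofReal (w y))) :
    0 < Var[fun ω => f ((Z 0 ω k).2) + ∑' n, (f ((Z 0 ω (k + n)).1) - f ((Z 0 ω (k + n)).2)); μ] := by
  have h := crnLag_untruncated_replica_variance_ge hw0 hmax Khat hK ν hlag hf ha hc k hZm hlaw
  linarith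

end Replicas

end Summit.Ventures.LatticeQCDFlow.Exactness

end
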